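import Summits.HodgeConjecture.HodgeConjecture.Theorems.PadicSemiregularLiftHodgeFermatVarietiesFibreOfBoundaryTwin
import Summits.HodgeConjecture.HodgeConjecture.Theorems.PadicSemiregularLiftHodgeFermatVarietiesTwinThirtyFive
import Summits.HodgeConjecture.HodgeConjecture.Theorems.PadicSemiregularLiftHodgeFermatVarietiesFibreOfTopLevelTwin
import Summits.HodgeConjecture.HodgeConjecture.Theorems.PadicSemiregularLiftHodgeFermatVarietiesExistsFibreOfNotPairedTwin
import HarnessLib

/-!
# Programme T6 assembled: the level analysis and the progression at length `≤ 6`, both small primes allowed — line `cancel-by-any-claim-lattice`, crux `HodgeFermatVarieties` (stmt-HodgeConjecture-1334)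

Lead c4's programme T6 (skeleton generation 16: the SEXTUPLE TWIN CORE `35 ∣ m`), stubs T6-L2a
`stub_fibre_of_top_level_le_six` and T6-L2 `stub_exists_fibre_of_not_paired_le_six` (registered signatures), by modus
ponens from the four landed pieces: the twin boundary brick T6-L1 `stub_fibre_of_boundary_twin`
(`…FibreOfBoundaryTwin`, the lead), the level-`35` kill T6-K `stub_twin_thirtyFive_even` (`…TwinThirtyFive`), and the
antecedent forms `stub_fibre_of_top_level_le_six_of` (`…FibreOfTopLevelTwin`: `#supp ≤ 5` — `5` is the only boundary
prime; `#supp = 6`, `M = 35` — the kill; otherwise the brick) and `stub_exists_fibre_of_not_paired_le_six_of`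
(`…ExistsFibreOfNotPairedTwin`). Statement of T6-L2: **a non-paired Hodge multiset of length `≤ 6` at a level `m`
prime to `6` contains, for `p₁ = 5` or `p₁ = 7` dividing `m`, all but one of the `p₁` points `A + j(m/p₁)` of a
progression with `p₁ A ≠ 0`.** The pay-off (every Hodge multiset of length `≤ 6` at a level prime to `6` is reachable;
HC for every Fermat fourfold of degree prime to `6`) is the sibling `…FourfoldCoprimeSixAll`. Everything here is proved.

References: [Aoki1983] N. Aoki, Math. Ann. 266 (1983) 23–54, Thm. A′ (§7), Prop. 2.2, Prop. 6.4.
-/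

-- every sibling file of the line declares into `…CancelByAnyClaimLattice.PairedNull` from a differently named module
set_option linter.dupNamespace false

noncomputable section
open Finset
open Literature.AlgebraicGeometry.HodgeTheory Literature.AlgebraicGeometry.HodgeTheory.FermatCharacter

namespace Summit.HodgeConjecture.HodgeConjecture.Theorems.CancelByAnyClaimLattice

namespace PairedNull

/-- **T6-L2a `stub_fibre_of_top_level_le_six` — the level analysis at length `≤ 6` with BOTH small primes allowed**
(registered signature): at a top non-even level `M` of a Hodge character of length `R ≤ 6` at a level prime to `6`,
some `p₁ ∈ {5, 7}` divides `M`, `M ≠ p₁`, and all but one of the `p₁` unit parts `x₀ + j(M/p₁)` occur at level `M`.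
[cite: Aoki1983, Thm. A′ (§7), Prop. 2.2, Prop. 6.4] -/
theorem stub_fibre_of_top_level_le_six : ∀ (R : ℕ), R ≤ 6 → ∀ {m : ℕ} [NeZero m] {α : Fin R → ZMod m}, m.Coprime 6 → FermatCharacter.IsHodge α → ∀ {M : ℕ}, M ∣ m → (∃ v : ZMod M, #(univ.filter fun i : Fin R ↦ m / m.gcd (α i).val = M ∧ ((((α i).val / (m / M)) : ℕ) : ZMod M) = -v) ≠ #(univ.filter fun i : Fin R ↦ m / m.gcd (α i).val = M ∧ ((((α i).val / (m / M)) : ℕ) : ZMod M) = v)) → (∀ M' : ℕ, M' ∣ m → M ∣ M' → M' ≠ M → ∀ u : ZMod M', #(univ.filter fun i : Fin R ↦ m / m.gcd (α i).val = M' ∧ ((((α i).val / (m / M')) : ℕ) : ZMod M') = -u) = #(univ.filter fun i : Fin R ↦ m / m.gcd (α i).val = M' ∧ ((((α i).val / (m / M')) : ℕ) : ZMod M') = u)) → ∃ p₁ : ℕ, (p₁ = 5 ∨ p₁ = 7) ∧ p₁ ∣ M ∧ M ≠ p₁ ∧ ∃ x₀ : ZMod M, IsUnit x₀ ∧ ∃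 j₀ : ℕ, j₀ < p₁ ∧ ∀ j : ℕ, j < p₁ → j ≠ j₀ → ∃ i : Fin R, m / m.gcd (α i).val = M ∧ ((((α i).val / (m / M)) : ℕ) : ZMod M) = x₀ + (j : ZMod M) * ((M / p₁ : ℕ) : ZMod M) :=
  stub_fibre_of_top_level_le_six_of stub_fibre_of_boundary_twin stub_twin_thirtyFive_even

/-- **T6-L2 `stub_exists_fibre_of_not_paired_le_six` — the progression at length `≤ 6`, both small primes allowed**
(registered signature): a non-paired Hodge multiset `s` of length `≤ 6` at a level `m` prime to `6` contains, for
`p₁ = 5` or `p₁ = 7` dividing `m`, all but one of the `p₁` points `A + j(m/p₁)` of a progression with `p₁ A ≠ 0`.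
[cite: Aoki1983, Thm. A′ (§7)] -/
theorem stub_exists_fibre_of_not_paired_le_six : ∀ (m : ℕ) [NeZero m], m.Coprime 6 → ∀ s : Multiset (ZMod m), IsHodgeMultiset s → Multiset.card s ≤ 6 → (∃ x : ZMod m, Multiset.count x s ≠ Multiset.count (-x) s) → ∃ p₁ : ℕ, (p₁ = 5 ∨ p₁ = 7) ∧ p₁ ∣ m ∧ ∃ A : ZMod m, (p₁ : ZMod m) * A ≠ 0 ∧ ∃ j₀ : ℕ, j₀ < p₁ ∧ ∀ j : ℕ, j < p₁ → j ≠ j₀ → A + (j : ZMod m) * ((m / p₁ : ℕ) : ZMod m) ∈ s :=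
  stub_exists_fibre_of_not_paired_le_six_of stub_fibre_of_top_level_le_six

end PairedNull

end Summit.HodgeConjecture.HodgeConjecture.Theorems.CancelByAnyClaimLattice
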